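import Mathlib.NumberTheory.PrimeCounting
import Literature.AlgebraicGeometry.Frobenioids.ModelFrobenioidTypeBridge
import Literature.AlgebraicGeometry.Frobenioids.CategoriesFactorization
import HarnessLib

/-!
# Frobenioids I, Theorem 5.2 (iii): a model Frobenioid has no anchors; standard type without the
"monoid on `D`" hypotheses

Mochizuki, *The geometry of Frobenioids I: the general theory*, Kyushu J. Math. **62** (2008)
293–400, §5, Theorem 5.2 (iii) p. 101 ("`C` is of standard type if and only if (a) … (b) … (c) …"),
with Remark 3.1.1 p. 57 ("an iso-subanchor of the Frobenioid `C` is never isotropic"), Prop. 1.10 (iv)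
p. 37 ("an anchor is never isotropic") and §0 pp. 17–18 (irreducible arrows, anchors, subanchors,
iso-subanchors). [cite: MochizukiFrdI2008, Thm. 5.2 (iii) p.101]

Proof-only companion (cell abc-iut, sub-DAG S7 row `FrdI:Prop5.5(iii)/P55-L07`, seat abc-iut-w4-d084).
The tree's `ModelFrobenioid.standardTypeIff_holds` (seat abc-iut-L1-t2) proves Thm. 5.2 (iii) under the
standing hypotheses of Thm. 5.2 (`ModelFrobenioid.Hypotheses`: `Φ` a divisorial MONOID ON `D`, …), which
enter only through clause (a) "quasi-isotropic type", obtained there from Rem. 3.1.1 for the FROBENIOID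
`C`.  Here the right-to-left direction is proved WITHOUT those hypotheses, directly in the model category:
* `isIrreducibleHom_of_prime_degFr` — a morphism `(p, f, 0, u)` of the model category with `f` an
  isomorphism of `D` and `p` prime is irreducible (`D` totally epimorphic, the `Φ(A)` sharp, `B`
  group-like): in a factorization the base maps are isomorphisms (epi + split mono), the zero divisors
  vanish (sharpness), and one of the Frobenius degrees is `1`, so that factor is an isomorphism;
* `not_isAnchor` — hence NO object `(A_D, α)` is an anchor: the Frobenius morphisms
  `(A_D, α) → (A_D, p · α)`, `p` prime, are irreducible and pairwise non-isomorphic under `(A_D, α)`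
  (Frobenius degrees), cf. Prop. 1.10 (iv); so there are no subanchors and no iso-subanchors, and the
  model category is of quasi-isotropic type (`data_isOfQuasiIsotropicType'`, every object being isotropic);
* `data_isOfStandardType_of` / `data_isOfStandardType_iff` — Thm. 5.2 (iii) (right to left / first
  sentence) for ANY `Φ`, `B`, `Div_B` with the `Φ(A)` sharp, `B` group-like and `D` totally epimorphic.
Used by the Prop. 5.5 (iii) closer for THE realification `C^rlf` (whose divisor monoid `Φ^rlf` need not be
a monoid on `D` in the tree's generality, cell finding P53-F1). No statement of the paper is strengthened
in its conclusion; nothing here bears on [IUTchIII] Cor. 3.12.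
-/

noncomputable section

namespace Literature.AlgebraicGeometry.Frobenioids

open CategoryTheory Opposite

universe w v u

namespace ModelFrobenioid

variable {D : Type u} [Category.{v} D] {Φ B : Dᵒᵖ ⥤ CommMonCat.{w}} {DivB : B ⟶ monoidGp Φ}

section Irreducible

variable {X Y : ModelFrobenioid Φ B DivB}

/-- **A base-isomorphic morphism with zero divisor `0` and PRIME Frobenius degree is irreducible**
(model category of `(Φ, B, Div_B)` with the `Φ(A)` sharp, `B` group-like, `D` totally epimorphic): in a
factorization `φ = α ∘ β` the base maps are isomorphisms (`Base(β)` is a split monomorphism and an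
epimorphism), `Base(β)^* Div(α) + deg_Fr(α) · Div(β) = Div(φ) = 0` forces `Div(α) = Div(β) = 0`, and
`deg_Fr(α) · deg_Fr(β)` prime forces one degree to be `1` — that factor is then an isomorphism
(`isIso_of`). [cite: MochizukiFrdI2008, Prop. 1.10 (iv) p.37] -/
theorem isIrreducibleHom_of_prime_degFr (hBg : Objectwise (fun M _ => IsGroupLike M) B)
    (hΦs : Objectwise (fun M _ => IsSharp M) Φ) (hD : IsTotallyEpimorphic D) (φ : X ⟶ Y)
    [IsIso (baseMap φ)] (hd : div φ = 1) (hp : (degFr φ : ℕ).Prime) : IsIrreducibleHom φ := by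
  refine ⟨fun hiso => ?_, fun W β α hβα => ?_⟩
  · have h1 := degFr_eq_one_of_isIso φ
    rw [h1, PNat.one_coe] at hp
    exact Nat.not_prime_one hp
  · -- the base maps are isomorphisms
    have hb : baseMap β ≫ baseMap α = baseMap φ := by rw [← baseMap_comp, hβα]
    haveI : IsSplitMono (baseMap β) :=
      IsSplitMono.mk' ⟨baseMap α ≫ inv (baseMap φ), by rw [← Category.assoc, hb, IsIso.hom_inv_id]⟩
    haveI : Epi (baseMap β) := hD.epi _
    haveI : IsIso (baseMap β) := isIso_of_epi_of_isSplitMono _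
    haveI : IsIso (baseMap α) := by
      have e : baseMap α = inv (baseMap β) ≫ baseMap φ := by rw [← hb, IsIso.inv_hom_id_assoc]
      rw [e]
      infer_instance
    -- the zero divisors vanish
    have hdiv : pull Φ (baseMap β) (div α) * div β ^ (degFr α : ℕ) = 1 := by
      rw [← div_comp_pull, hβα, hd]
    have hα1 : div α = 1 := by
      have h1 : pull Φ (baseMap β) (div α) = 1 :=
        (hΦs X.base).eq_one_of_isUnit _ (IsUnit.of_mul_eq_one _ hdiv)
      have h2 := congrArg (pull Φ (inv (baseMap β))) h1
      rwa [← pull_comp, IsIso.inv_hom_id, pull_id, map_one] at h2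
    have hβ1 : div β = 1 := by
      have h1 : div β ^ (degFr α : ℕ) = 1 :=
        (hΦs X.base).eq_one_of_isUnit _ (IsUnit.of_mul_eq_one_right _ hdiv)
      exact (hΦs X.base).eq_one_of_isUnit _ (IsUnit.of_pow_eq_one h1 (PNat.ne_zero _))
    -- one of the Frobenius degrees is `1`
    have hdeg : ((degFr α : ℕ+) : ℕ) * (degFr β : ℕ) = (degFr φ : ℕ) := by
      rw [← PNat.mul_coe, ← degFr_comp, hβα]
    rw [← hdeg] at hp
    rcases Nat.prime_mul_iff.mp hp with ⟨-, h1⟩ | ⟨-, h1⟩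
    · exact Or.inr (isIso_of hBg β hβ1 (PNat.coe_inj.mp (h1.trans PNat.one_coe.symm)))
    · exact Or.inl (isIso_of hBg α hα1 (PNat.coe_inj.mp (h1.trans PNat.one_coe.symm)))

end Irreducible

/-- **No object of a model Frobenioid is an anchor** (Prop. 1.10 (iv) "an anchor is never isotropic" in
the model category, whose objects are all isotropic): the Frobenius morphisms
`(p, id, 0, 0) : (A_D, α) → (A_D, p · α)`, `p` prime, are irreducible and have pairwise distinct
Frobenius degrees, hence give infinitely many isomorphism classes of irreducible arrows out of `(A_D, α)`.
[cite: MochizukiFrdI2008, Prop. 1.10 (iv) p.37] -/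
theorem not_isAnchor (hBg : Objectwise (fun M _ => IsGroupLike M) B)
    (hΦs : Objectwise (fun M _ => IsSharp M) Φ) (hD : IsTotallyEpimorphic D)
    (X : ModelFrobenioid Φ B DivB) : ¬ IsAnchor X := by
  -- pattern adapted from `ArchimedeanIsoSubanchorIsotropy.not_isAnchor_of_isotropic` (same tree)
  intro hfin
  let P : ℕ → ℕ+ := fun n => ⟨Nat.nth Nat.Prime n, (Nat.prime_nth_prime n).pos⟩
  have hP : ∀ n, ((P n : ℕ+) : ℕ).Prime := fun n => Nat.prime_nth_prime n
  let T : ℕ+ → ModelFrobenioid Φ B DivB := fun p => ⟨X.base, X.cls ^ (p : ℕ)⟩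
  have hrel : ∀ p : ℕ+, X.cls ^ (p : ℕ) * Algebra.GrothendieckGroup.of (1 : Φ.obj (op X.base)) =
      pullGp Φ (𝟙 X.base) (T p).cls * divB Φ B DivB (op X.base) 1 := fun p => by
    rw [map_one, mul_one, map_one, mul_one, pullGp_id]
  let fr : ∀ p : ℕ+, X ⟶ T p := fun p => mkHom X (T p) p (𝟙 X.base) 1 1 (hrel p)
  have hirr : ∀ p : ℕ+, (p : ℕ).Prime → IsIrreducibleHom (fr p) := fun p hp => by
    haveI : IsIso (baseMap (fr p)) := by
      show IsIso (𝟙 X.base)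
      infer_instance
    exact isIrreducibleHom_of_prime_degFr hBg hΦs hD (fr p) rfl hp
  let g : ℕ → Quotient (isIsomorphicSetoid (Under X)) := fun n => Quotient.mk _ (Under.mk (fr (P n)))
  have hg : Function.Injective g := by
    intro m n hmn
    obtain ⟨e⟩ := Quotient.exact hmn
    have w := Under.w e.hom
    have hd := congrArg (fun k => (degFr k : ℕ)) w
    change ((degFr (fr (P m) ≫ e.hom.right) : ℕ+) : ℕ) = ((P n : ℕ+) : ℕ) at hd
    rw [degFr_comp, PNat.mul_coe] at hd
    have hdvd : ((P m : ℕ+) : ℕ) ∣ ((P n : ℕ+) : ℕ) := Dvd.intro_left _ hd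
    have := (Nat.prime_dvd_prime_iff_eq (hP m) (hP n)).1 hdvd
    exact Nat.nth_injective Nat.infinite_setOf_prime this
  refine Set.infinite_of_injective_forall_mem hg (fun n => ?_) hfin
  exact ⟨Under.mk (fr (P n)), hirr _ (hP n), rfl⟩

/-- Hence no object of a model Frobenioid is an iso-subanchor (there being no anchors, there are no
subanchors). [cite: MochizukiFrdI2008, Rem. 3.1.1 p.57] -/
theorem not_isIsoSubanchor (hBg : Objectwise (fun M _ => IsGroupLike M) B)
    (hΦs : Objectwise (fun M _ => IsSharp M) Φ) (hD : IsTotallyEpimorphic D)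
    (A : ModelFrobenioid Φ B DivB) : ¬ IsIsoSubanchor A := by
  intro h
  unfold IsIsoSubanchor IsSubanchor at h
  obtain ⟨A', -, -, ⟨A'', hA'', -⟩, -⟩ := h
  exact not_isAnchor hBg hΦs hD A'' hA''

/-- **A model Frobenioid is of quasi-isotropic type** (Def. 3.1 (i)(a)) as soon as the `Φ(A)` are sharp,
`B` is group-like and `D` is totally epimorphic: every object is isotropic and none is an iso-subanchor.
[cite: MochizukiFrdI2008, Thm. 5.2 (iii) p.102] -/
theorem data_isOfQuasiIsotropicType' (hBg : Objectwise (fun M _ => IsGroupLike M) B)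
    (hΦs : Objectwise (fun M _ => IsSharp M) Φ) (hD : IsTotallyEpimorphic D) :
    (data Φ B DivB).IsOfQuasiIsotropicType :=
  ⟨fun A => ⟨fun h => (h ((data_isOfIsotropicType hBg).obj A)).elim,
    fun h => (not_isIsoSubanchor hBg hΦs hD A h).elim⟩⟩

variable (Φ B DivB) in
/-- **Thm. 5.2 (iii), right to left, without the "monoid on `D`" hypotheses**: if (a) `C` admits a
Frobenius-compact object in case `Φ` is the zero monoid, (b) `D` is of FSMFF-type and (c) `Φ` is
non-dilating, then the model category of `(Φ, B, Div_B)` is of standard type — for ANY `Φ` with sharp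
values, `B` group-like and `D` totally epimorphic (quasi-isotropic by `data_isOfQuasiIsotropicType'`,
Frobenius-isotropic and Frobenius-normalized by seat abc-iut-L1-t2's bridge lemmas).
[cite: MochizukiFrdI2008, Thm. 5.2 (iii) p.101] -/
theorem data_isOfStandardType_of (hBg : Objectwise (fun M _ => IsGroupLike M) B)
    (hΦs : Objectwise (fun M _ => IsSharp M) Φ) (hD : IsTotallyEpimorphic D)
    (ha : IsZeroMonoid Φ → ∃ X : ModelFrobenioid Φ B DivB, (data Φ B DivB).IsFrobeniusCompact X)
    (hb : IsOfFSMFFType D) (hc : IsNonDilatingOn Φ) : (data Φ B DivB).IsOfStandardType :=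
  { quasiIsotropic := data_isOfQuasiIsotropicType' hBg hΦs hD
    frobeniusIsotropic := data_isOfFrobeniusIsotropicType hBg
    frobeniusCompact_of_groupLike := fun hg => by
      obtain ⟨X, hX⟩ := ha ((data_isOfGroupLikeType_iff Φ B DivB).mp hg)
      exact ⟨X, (data_isOfIsotropicType hBg).obj X, hX⟩
    frobeniusNormalized := data_isOfFrobeniusNormalizedType
    fsmff := hb
    nonDilating := (data_isNonDilatingOn_iff Φ B DivB).mpr hc }

variable (Φ B DivB) in
/-- **Thm. 5.2 (iii), first sentence, for ANY `Φ` with sharp values, `B` group-like and `D` totally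
epimorphic** (the tree's `standardTypeIff_holds`, seat abc-iut-L1-t2, assumes the standing hypotheses of
Thm. 5.2 instead): the model category of `(Φ, B, Div_B)` is of standard type iff (a) it admits a
Frobenius-compact object in case `Φ` is the zero monoid, (b) `D` is of FSMFF-type and (c) `Φ` is
non-dilating. [cite: MochizukiFrdI2008, Thm. 5.2 (iii) p.101] -/
theorem data_isOfStandardType_iff (hBg : Objectwise (fun M _ => IsGroupLike M) B)
    (hΦs : Objectwise (fun M _ => IsSharp M) Φ) (hD : IsTotallyEpimorphic D) :
    (data Φ B DivB).IsOfStandardType ↔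
      (IsZeroMonoid Φ → ∃ X : ModelFrobenioid Φ B DivB, (data Φ B DivB).IsFrobeniusCompact X) ∧
        IsOfFSMFFType D ∧ IsNonDilatingOn Φ := by
  refine ⟨fun hs => ⟨fun h0 => ?_, hs.fsmff, (data_isNonDilatingOn_iff Φ B DivB).mp hs.nonDilating⟩,
    fun h => data_isOfStandardType_of Φ B DivB hBg hΦs hD h.1 h.2.1 h.2.2⟩
  obtain ⟨A, -, hA⟩ := hs.frobeniusCompact_of_groupLike ((data_isOfGroupLikeType_iff Φ B DivB).mpr h0)
  exact ⟨A, hA⟩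

end ModelFrobenioid

end Literature.AlgebraicGeometry.Frobenioids
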